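import Summits.AtomisticToContinuum.HydrodynamicLimit.Theses.RelayRaceLocality
import Summits.AtomisticToContinuum.HydrodynamicLimit.Theorems.TwoClocksClampedWindowDockActivityInversion
import Summits.AtomisticToContinuum.HydrodynamicLimit.Theorems.TwoClocksClampedWindowDockReferenceLLN
import Literature.MathematicalPhysics.KineticTheory.HardSphereEulerProofs
import HarnessLib

/-!
# `RestartPrinciple` (stmt-AtomisticToContinuum-12503), line `Sketch`: REALISABILITY, and BET 2 from FORGETTING

Route `RelayRaceLocality`, crux `RestartPrinciple = (S → G)`, line `Sketch` (idea `glauber-laundering-restart`,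
skeleton `Cruxes/RestartPrinciple/Lines/Sketch.lean`). The line restarts the short-time hydrodynamic limit at
every restart time `s₀` from a FRESH local Gibbs gas carrying the time-`s₀` Euler data ("laundering in law",
BET 2 of the skeleton = the statement the landed glue `stub_restartGlue`, p101649, consumes). BET 2 has a
static half and a dynamic half:

* `realisability` — the STATIC half is known mathematics, assembled here from the tree: every continuous
  positive unit-mass density `r` in the dilute band `r σ³ ≤ η₁` (`0 < σ < 1/2`) is the time-`0`
  law-of-large-numbers density of a fresh local Gibbs hard-sphere gas with some continuous positive activity,
  for any continuous velocity and positive temperature profile, through every flow family — activity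
  inversion `EntropyClockDock.exists_activity_of_density` (route TwoClocks' dock, scale-free: the only
  smallness is the packing) + the fixed-`σ` local-equilibrium LLN `EntropyClockDock.tie_rhoLim_of_smallDensity`;
* `integral_density_eq_one_of_lln` — unit mass wherever the LLN holds (test against `χ ≡ 1`; the laws are
  probability measures for `σ ≤ 1/2`), which feeds the time-`s₀` density into `realisability`;
* `launderedRestart_of_forgetting` — BET 2 (verbatim) from its DYNAMIC half alone, the registered stub
  `stub_forgetting` taken as a hypothesis: LAW-LEVEL FORGETTING at a restart time (any fresh local Gibbs gas
  realising the time-`s₀` data reproduces the forward bounded-Lipschitz statistics of the true law on a short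
  window, under the guards). FORGETTING is the open research bet of the line; this file makes the reduction
  of BET 2 to it kernel-checked.

No definitions. prover-line-stmt-AtomisticToContinuum-12503-c2-0 (lead c2), 2026-08-16.
-/

noncomputable section

open Literature.MathematicalPhysics.KineticTheory Literature.Analysis.FluidPDE
open Literature.Analysis.FunctionSpaces MeasureTheory Filter Set
open Summit.AtomisticToContinuum.HydrodynamicLimit.Theses.RelayRaceLocality

namespace Summit.AtomisticToContinuum.HydrodynamicLimit.Theorems.RestartPrinciple

/-- Unit mass at a time where the law of large numbers holds: testing the LLN against `χ ≡ 1` (the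
empirical density of `1` is `1`, the laws are probability measures for `σ ≤ 1/2`). -/
theorem integral_density_eq_one_of_lln {σ : ℝ} {a₀ θ₀ : T3 → ℝ} {u₀ : T3 → V3} (ha : Continuous a₀)
    (hθ : Continuous θ₀) (hu : Continuous u₀) (ha0 : ∀ x, 0 < a₀ x) (hθ0 : ∀ x, 0 < θ₀ x)
    (hσ2 : σ ≤ 1 / 2) {ρ θ : ℝ → T3 → ℝ} {u : ℝ → T3 → V3}
    {Φ : (N : ℕ) → HardSphereFlow (Torus.geometry (Fin 3)) (hsDiameter σ N) (N + 1)} {s : ℝ}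
    (h : TendstoHydroFieldsAt (fun N => localGibbsLaw σ a₀ u₀ θ₀ N (Φ N)) Φ ρ u θ s) :
    ∫ x, ρ s x = 1 := by
  by_contra hne
  set δ : ℝ := |1 - ∫ x, ρ s x| / 2 with hδ
  have hδpos : 0 < δ := by
    have : (1 : ℝ) - ∫ x, ρ s x ≠ 0 := fun h0 => hne (by linarith)
    positivity
  have hlim := (h (fun _ => (1 : ℝ)) continuous_const δ hδpos).1
  have hset : ∀ N : ℕ, {z : Config (N + 1) (Fin 3) T3 |
      δ < |empiricalDensityField ((Φ N).flow s z) (fun _ => (1 : ℝ)) - ∫ x, (1 : ℝ) * ρ s x|} =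
      Set.univ := by
    intro N
    refine Set.eq_univ_of_forall fun z => ?_
    simp only [Set.mem_setOf_eq, empiricalDensityField_one (Nat.succ_ne_zero N), one_mul]
    rw [hδ]
    have hpos : 0 < |1 - ∫ x, ρ s x| := by positivity
    linarith
  have hone : ∀ N : ℕ, localGibbsLaw σ a₀ u₀ θ₀ N (Φ N) {z : Config (N + 1) (Fin 3) T3 |
      δ < |empiricalDensityField ((Φ N).flow s z) (fun _ => (1 : ℝ)) - ∫ x, (1 : ℝ) * ρ s x|} = 1 := by
    intro N
    haveI := isProbabilityMeasure_localGibbsLaw ha hθ hu ha0 hθ0 hσ2 N (Φ N)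
    rw [hset N, measure_univ]
  have h1 : Tendsto (fun _ : ℕ => (1 : ENNReal)) atTop (nhds 0) := hlim.congr hone
  exact zero_ne_one (tendsto_nhds_unique h1 tendsto_const_nhds)

/-- **REALISABILITY (static half of BET 2) — known mathematics, from the tree.** Every continuous positive
unit-mass density `r` in the dilute band `r σ³ ≤ η₁` (`0 < σ < 1/2`) is the time-`0` law-of-large-numbers density
of a FRESH local Gibbs hard-sphere gas with some continuous positive activity `a`, for any continuous velocity
`u'` and temperature `θ' > 0`, through every flow family: activity inversion
`EntropyClockDock.exists_activity_of_density` (`rhoLim (profileOf a) σ = r`, `SmallDensity (profileOf a) σ`)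
+ the fixed-`σ` local-equilibrium LLN `EntropyClockDock.tie_rhoLim_of_smallDensity`. -/
theorem realisability :
    ∃ η₁ : ℝ, 0 < η₁ ∧ ∀ σ : ℝ, 0 < σ → σ < 1 / 2 →
      ∀ (r θ' : T3 → ℝ) (u' : T3 → V3), Continuous r → Continuous θ' → Continuous u' →
      (∀ x, 0 < r x) → (∀ x, 0 < θ' x) → (∫ x, r x) = 1 → (∀ x, r x * σ ^ 3 ≤ η₁) →
      ∃ a : T3 → ℝ, Continuous a ∧ (∀ x, 0 < a x) ∧
        ∀ Φ : (N : ℕ) → HardSphereFlow (Torus.geometry (Fin 3)) (hsDiameter σ N) (N + 1),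
          TendstoHydroFieldsAt (fun N => localGibbsLaw σ a u' θ' N (Φ N)) Φ
            (fun _ => r) (fun _ => u') (fun _ => θ') 0 := by
  obtain ⟨η₁, hη₁, hinv⟩ := EntropyClockDock.exists_activity_of_density
  refine ⟨η₁, hη₁, fun σ hσ hσ2 r θ' u' hr hθ' hu' hr0 hθ0 hmass hpack => ?_⟩
  have hσ3 : 0 < σ ^ 3 := pow_pos hσ 3
  have hsup : σ ^ 3 * (⨆ x, r x) ≤ η₁ := by
    have h1 : (⨆ x, r x) ≤ η₁ / σ ^ 3 := by
      refine ciSup_le fun x => ?_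
      rw [le_div_iff₀ hσ3]
      exact hpack x
    calc σ ^ 3 * (⨆ x, r x) ≤ σ ^ 3 * (η₁ / σ ^ 3) := mul_le_mul_of_nonneg_left h1 hσ3.le
      _ = η₁ := mul_div_cancel₀ _ hσ3.ne'
  obtain ⟨a, ha, ha0, -, hS, hlim⟩ := hinv σ hσ hσ2 r hr hr0 hmass hsup
  refine ⟨a, ha, ha0, fun Φ => ?_⟩
  have h := EntropyClockDock.tie_rhoLim_of_smallDensity ha hθ' hu' ha0 hθ0 hσ2.le hS Φ
  rwa [hlim] at h

/-- **BET 2 from FORGETTING.** LAUNDERING IN LAW (verbatim the statement the landed glue `stub_restartGlue`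
consumes) follows from law-level FORGETTING alone (the registered stub `stub_forgetting`, here the hypothesis
`hForget`): the time-`s₀` density `ρ s₀` — continuous, positive, unit mass by the LLN at `s₀`, packing `< η₀` —
is realised by a fresh local Gibbs gas (`realisability`), to which FORGETTING is applied. -/
theorem launderedRestart_of_forgetting :
    (∃ η₀ : ℝ, 0 < η₀ ∧ ∀ (a₀ θ₀ : T3 → ℝ) (u₀ : T3 → V3), Continuous a₀ → Continuous θ₀ →
      Continuous u₀ → (∀ x, 0 < a₀ x) → (∀ x, 0 < θ₀ x) → ∃ σ₀ : ℝ, 0 < σ₀ ∧ ∀ σ : ℝ, 0 < σ →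
      σ < σ₀ → ∀ M : ℝ, 0 < M → ∃ τ : ℝ, 0 < τ ∧ ∀ (T : ℝ) (ρ θ : ℝ → T3 → ℝ) (u : ℝ → T3 → V3),
      IsHardSphereEulerSolution σ T ρ u θ →
      ∀ Φ : (N : ℕ) → HardSphereFlow (Torus.geometry (Fin 3)) (hsDiameter σ N) (N + 1),
      ∀ s₀ ∈ Set.Ico 0 T,
      (∀ s ∈ Set.Icc 0 s₀,
        TendstoHydroFieldsAt (fun N => localGibbsLaw σ a₀ u₀ θ₀ N (Φ N)) Φ ρ u θ s) →
      (∀ s ∈ Set.Icc 0 s₀, ∀ x, ρ s x * σ ^ 3 < η₀ ∧ ρ s x ≤ M ∧ θ s x ≤ M ∧ M⁻¹ ≤ θ s x ∧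
        ‖u s x‖ ≤ M ∧ ∀ i j k : Fin 3, |Torus.partialDeriv i (ρ s) x| ≤ M ∧
        ‖Torus.partialDeriv i (u s) x‖ ≤ M ∧ |Torus.partialDeriv i (θ s) x| ≤ M ∧
        |Torus.partialDeriv i (Torus.partialDeriv j (ρ s)) x| ≤ M ∧
        ‖Torus.partialDeriv i (Torus.partialDeriv j (u s)) x‖ ≤ M ∧
        |Torus.partialDeriv i (Torus.partialDeriv j (θ s)) x| ≤ M ∧
        |Torus.partialDeriv i (Torus.partialDeriv j (Torus.partialDeriv k (ρ s))) x| ≤ M ∧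
        ‖Torus.partialDeriv i (Torus.partialDeriv j (Torus.partialDeriv k (u s))) x‖ ≤ M ∧
        |Torus.partialDeriv i (Torus.partialDeriv j (Torus.partialDeriv k (θ s))) x| ≤ M) →
      ∀ a : T3 → ℝ, Continuous a → (∀ x, 0 < a x) →
        TendstoHydroFieldsAt (fun N => localGibbsLaw σ a (u s₀) (θ s₀) N (Φ N)) Φ
          (fun t => ρ (s₀ + t)) (fun t => u (s₀ + t)) (fun t => θ (s₀ + t)) 0 →
        ∀ w : ℝ, 0 ≤ w → w ≤ τ → s₀ + w < T →
        (∀ s ∈ Set.Icc 0 (s₀ + w), ∀ x, ρ s x * σ ^ 3 < η₀ ∧ ρ s x ≤ M ∧ θ s x ≤ M ∧ M⁻¹ ≤ θ s x ∧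
        ‖u s x‖ ≤ M ∧ ∀ i j k : Fin 3, |Torus.partialDeriv i (ρ s) x| ≤ M ∧
        ‖Torus.partialDeriv i (u s) x‖ ≤ M ∧ |Torus.partialDeriv i (θ s) x| ≤ M ∧
        |Torus.partialDeriv i (Torus.partialDeriv j (ρ s)) x| ≤ M ∧
        ‖Torus.partialDeriv i (Torus.partialDeriv j (u s)) x‖ ≤ M ∧
        |Torus.partialDeriv i (Torus.partialDeriv j (θ s)) x| ≤ M ∧
        |Torus.partialDeriv i (Torus.partialDeriv j (Torus.partialDeriv k (ρ s))) x| ≤ M ∧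
        ‖Torus.partialDeriv i (Torus.partialDeriv j (Torus.partialDeriv k (u s))) x‖ ≤ M ∧
        |Torus.partialDeriv i (Torus.partialDeriv j (Torus.partialDeriv k (θ s))) x| ≤ M) →
        ∀ χ : T3 → ℝ, Continuous χ →
          (∀ F : ℝ → ℝ, LipschitzWith 1 F → (∀ p, |F p| ≤ 1) →
            Tendsto (fun N => (∫ z, F (empiricalDensityField ((Φ N).flow (s₀ + w) z) χ)
                ∂(localGibbsLaw σ a₀ u₀ θ₀ N (Φ N))) -
              ∫ z, F (empiricalDensityField ((Φ N).flow w z) χ)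
                ∂(localGibbsLaw σ a (u s₀) (θ s₀) N (Φ N))) atTop (nhds 0)) ∧
          (∀ F : V3 → ℝ, LipschitzWith 1 F → (∀ p, |F p| ≤ 1) →
            Tendsto (fun N => (∫ z, F (empiricalMomentumField ((Φ N).flow (s₀ + w) z) χ)
                ∂(localGibbsLaw σ a₀ u₀ θ₀ N (Φ N))) -
              ∫ z, F (empiricalMomentumField ((Φ N).flow w z) χ)
                ∂(localGibbsLaw σ a (u s₀) (θ s₀) N (Φ N))) atTop (nhds 0)) ∧
          (∀ F : ℝ → ℝ, LipschitzWith 1 F → (∀ p, |F p| ≤ 1) →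
            Tendsto (fun N => (∫ z, F (empiricalEnergyField ((Φ N).flow (s₀ + w) z) χ)
                ∂(localGibbsLaw σ a₀ u₀ θ₀ N (Φ N))) -
              ∫ z, F (empiricalEnergyField ((Φ N).flow w z) χ)
                ∂(localGibbsLaw σ a (u s₀) (θ s₀) N (Φ N))) atTop (nhds 0))) →
    ∃ η₀ : ℝ, 0 < η₀ ∧ ∀ (a₀ θ₀ : T3 → ℝ) (u₀ : T3 → V3), Continuous a₀ → Continuous θ₀ →
      Continuous u₀ → (∀ x, 0 < a₀ x) → (∀ x, 0 < θ₀ x) → ∃ σ₀ : ℝ, 0 < σ₀ ∧ ∀ σ : ℝ, 0 < σ →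
      σ < σ₀ → ∀ M : ℝ, 0 < M → ∃ τ : ℝ, 0 < τ ∧ ∀ (T : ℝ) (ρ θ : ℝ → T3 → ℝ) (u : ℝ → T3 → V3),
      IsHardSphereEulerSolution σ T ρ u θ →
      ∀ Φ : (N : ℕ) → HardSphereFlow (Torus.geometry (Fin 3)) (hsDiameter σ N) (N + 1),
      ∀ s₀ ∈ Set.Ico 0 T,
      (∀ s ∈ Set.Icc 0 s₀,
        TendstoHydroFieldsAt (fun N => localGibbsLaw σ a₀ u₀ θ₀ N (Φ N)) Φ ρ u θ s) →
      (∀ s ∈ Set.Icc 0 s₀, ∀ x, ρ s x * σ ^ 3 < η₀ ∧ ρ s x ≤ M ∧ θ s x ≤ M ∧ M⁻¹ ≤ θ s x ∧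
        ‖u s x‖ ≤ M ∧ ∀ i j k : Fin 3, |Torus.partialDeriv i (ρ s) x| ≤ M ∧
        ‖Torus.partialDeriv i (u s) x‖ ≤ M ∧ |Torus.partialDeriv i (θ s) x| ≤ M ∧
        |Torus.partialDeriv i (Torus.partialDeriv j (ρ s)) x| ≤ M ∧
        ‖Torus.partialDeriv i (Torus.partialDeriv j (u s)) x‖ ≤ M ∧
        |Torus.partialDeriv i (Torus.partialDeriv j (θ s)) x| ≤ M ∧
        |Torus.partialDeriv i (Torus.partialDeriv j (Torus.partialDeriv k (ρ s))) x| ≤ M ∧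
        ‖Torus.partialDeriv i (Torus.partialDeriv j (Torus.partialDeriv k (u s))) x‖ ≤ M ∧
        |Torus.partialDeriv i (Torus.partialDeriv j (Torus.partialDeriv k (θ s))) x| ≤ M) →
      ∃ a : T3 → ℝ, Continuous a ∧ (∀ x, 0 < a x) ∧
        TendstoHydroFieldsAt (fun N => localGibbsLaw σ a (u s₀) (θ s₀) N (Φ N)) Φ
          (fun t => ρ (s₀ + t)) (fun t => u (s₀ + t)) (fun t => θ (s₀ + t)) 0 ∧
        ∀ w : ℝ, 0 ≤ w → w ≤ τ → s₀ + w < T →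
        (∀ s ∈ Set.Icc 0 (s₀ + w), ∀ x, ρ s x * σ ^ 3 < η₀ ∧ ρ s x ≤ M ∧ θ s x ≤ M ∧ M⁻¹ ≤ θ s x ∧
        ‖u s x‖ ≤ M ∧ ∀ i j k : Fin 3, |Torus.partialDeriv i (ρ s) x| ≤ M ∧
        ‖Torus.partialDeriv i (u s) x‖ ≤ M ∧ |Torus.partialDeriv i (θ s) x| ≤ M ∧
        |Torus.partialDeriv i (Torus.partialDeriv j (ρ s)) x| ≤ M ∧
        ‖Torus.partialDeriv i (Torus.partialDeriv j (u s)) x‖ ≤ M ∧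
        |Torus.partialDeriv i (Torus.partialDeriv j (θ s)) x| ≤ M ∧
        |Torus.partialDeriv i (Torus.partialDeriv j (Torus.partialDeriv k (ρ s))) x| ≤ M ∧
        ‖Torus.partialDeriv i (Torus.partialDeriv j (Torus.partialDeriv k (u s))) x‖ ≤ M ∧
        |Torus.partialDeriv i (Torus.partialDeriv j (Torus.partialDeriv k (θ s))) x| ≤ M) →
        ∀ χ : T3 → ℝ, Continuous χ →
          (∀ F : ℝ → ℝ, LipschitzWith 1 F → (∀ p, |F p| ≤ 1) →
            Tendsto (fun N => (∫ z, F (empiricalDensityField ((Φ N).flow (s₀ + w) z) χ)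
                ∂(localGibbsLaw σ a₀ u₀ θ₀ N (Φ N))) -
              ∫ z, F (empiricalDensityField ((Φ N).flow w z) χ)
                ∂(localGibbsLaw σ a (u s₀) (θ s₀) N (Φ N))) atTop (nhds 0)) ∧
          (∀ F : V3 → ℝ, LipschitzWith 1 F → (∀ p, |F p| ≤ 1) →
            Tendsto (fun N => (∫ z, F (empiricalMomentumField ((Φ N).flow (s₀ + w) z) χ)
                ∂(localGibbsLaw σ a₀ u₀ θ₀ N (Φ N))) -
              ∫ z, F (empiricalMomentumField ((Φ N).flow w z) χ)
                ∂(localGibbsLaw σ a (u s₀) (θ s₀) N (Φ N))) atTop (nhds 0)) ∧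
          (∀ F : ℝ → ℝ, LipschitzWith 1 F → (∀ p, |F p| ≤ 1) →
            Tendsto (fun N => (∫ z, F (empiricalEnergyField ((Φ N).flow (s₀ + w) z) χ)
                ∂(localGibbsLaw σ a₀ u₀ θ₀ N (Φ N))) -
              ∫ z, F (empiricalEnergyField ((Φ N).flow w z) χ)
                ∂(localGibbsLaw σ a (u s₀) (θ s₀) N (Φ N))) atTop (nhds 0)) := by
  intro hForget
  obtain ⟨η₁, hη₁, hR⟩ := realisability
  obtain ⟨ηF, hηF, hF⟩ := hForget
  refine ⟨min η₁ ηF, lt_min hη₁ hηF, fun a₀ θ₀ u₀ ha hθ hu ha0 hθ0 => ?_⟩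
  obtain ⟨σF, hσF, hF⟩ := hF a₀ θ₀ u₀ ha hθ hu ha0 hθ0
  refine ⟨min σF (1 / 2), lt_min hσF one_half_pos, fun σ hσ hσlt M hM => ?_⟩
  have hσF' : σ < σF := lt_of_lt_of_le hσlt (min_le_left _ _)
  have hσ2 : σ < 1 / 2 := lt_of_lt_of_le hσlt (min_le_right _ _)
  obtain ⟨τ, hτ, hF⟩ := hF σ hσ hσF' M hM
  refine ⟨τ, hτ, fun T ρ θ u hsol Φ s₀ hs₀ hprev hguard => ?_⟩
  -- the time-`s₀` data: continuous, positive, unit mass, dilute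
  have hρc : Continuous (ρ s₀) := (hsol.smooth_density.isSmooth_slice hs₀).continuous
  have huc : Continuous (u s₀) := (hsol.smooth_velocity.isSmooth_slice hs₀).continuous
  have hθc : Continuous (θ s₀) := (hsol.smooth_temperature.isSmooth_slice hs₀).continuous
  have hρ0 : ∀ x, 0 < ρ s₀ x := hsol.density_pos s₀ hs₀
  have hθ0' : ∀ x, 0 < θ s₀ x := hsol.temperature_pos s₀ hs₀
  have hmass : ∫ x, ρ s₀ x = 1 :=
    integral_density_eq_one_of_lln ha hθ hu ha0 hθ0 hσ2.le (hprev s₀ ⟨hs₀.1, le_rfl⟩)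
  have hpack₁ : ∀ x, ρ s₀ x * σ ^ 3 ≤ η₁ := fun x =>
    (hguard s₀ ⟨hs₀.1, le_rfl⟩ x).1.le.trans (min_le_left _ _)
  -- realisability: a fresh local Gibbs gas with the time-`s₀` data
  obtain ⟨g, hg, hg0, hlln⟩ := hR σ hσ hσ2 (ρ s₀) (θ s₀) (u s₀) hρc hθc huc hρ0 hθ0' hmass hpack₁
  have hfresh : TendstoHydroFieldsAt (fun N => localGibbsLaw σ g (u s₀) (θ s₀) N (Φ N)) Φ
      (fun t => ρ (s₀ + t)) (fun t => u (s₀ + t)) (fun t => θ (s₀ + t)) 0 := by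
    intro χ hχ δ hδ
    simpa only [add_zero] using hlln Φ χ hχ δ hδ
  refine ⟨g, hg, hg0, hfresh, fun w hw hwτ hwT hguardw => ?_⟩
  -- forgetting, with the guards weakened from `η₀` to `ηF`
  have hle : min η₁ ηF ≤ ηF := min_le_right _ _
  exact hF T ρ θ u hsol Φ s₀ hs₀ hprev
    (fun s hs x => ⟨lt_of_lt_of_le (hguard s hs x).1 hle, (hguard s hs x).2⟩) g hg hg0 hfresh w hw
    hwτ hwT (fun s hs x => ⟨lt_of_lt_of_le (hguardw s hs x).1 hle, (hguardw s hs x).2⟩)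

end Summit.AtomisticToContinuum.HydrodynamicLimit.Theorems.RestartPrinciple

end
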